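import Summits.ResolutionOfSingularities.ResolutionOfSingularities.Theorems.WeightedInvariantIota3DropCurveFracNormal
import HarnessLib

/-!
# (D-b³-curve-FRAC-TIE), first reduction step: with a FRACTIONAL AQS slope the AQS-admissible elements lie in `(y^ν) + 𝒥_{bν+1}((y, x); (b, 1))`
# (door `HypersurfaceCentreConstruction`, stmt-ResolutionOfSingularities-19897; gap list `keyRungGrHomLE_three_of_tieDescent_point_curveFracTie`)

Helper for `stub_keyRungGrHomLE_three` (def-free, `--supports 19897`).  Sequel of hand -8's …Iota3DropCurveFracNormal (`b_max = b = ⌊r/q⌋`,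
`J₃ᵗ = 𝒥((y, x); (b, 1))` on the AQS-adapted pair).  CURVE-TIE.md §3 (a): when `q ∤ r` every monomial `y^j x^i` with `r j + q i ≥ r ν` and `j < ν`
has `b j + i ≥ b ν + 1` — so an AQS-admissible `f` is `c·y^ν` modulo the NEXT integer piece `𝒥_{bν+1}((y, x); (b, 1))`, which is why the strict
transform of `f` in the `x`-chart of the cobordant blow-up of `J₃ᵗ` is `≡ c Y^ν (mod s)` and the only successor over `𝔪` that can keep the order
is `(s, Y, z)`.

* `Iota3.div_mul_succ_le_of_weights` — the arithmetic: `q ∤ r`, `j < ν`, `r ν ≤ r j + q i` ⟹ `⌊r/q⌋ ν + 1 ≤ ⌊r/q⌋ j + i`.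
* **`Iota3.weightedMonomialIdeal_le_span_pow_sup_div_succ`** — `𝒥_{rν}((y, x); (r, q)) ≤ (y^ν) ⊔ 𝒥_{⌊r/q⌋ν+1}((y, x); (⌊r/q⌋, 1))` for `q ∤ r`.
* **`Iota3.mem_weightedMonomialIdeal_of_curve_lexMax`**, **`Iota3.mem_span_pow_sup_of_curve_lexMax_frac`** — at a curve centre with
  `S`-presented AQS germ `(y/1, x/1; r, q; rν)`: `f ∈ 𝒥_{rν}((y, x); (r, q))` IN `S` (contraction through
  `ContactCylinder.comap_map_weightedMonomialIdeal_eq_of_linearIndependent`), hence for `q ∤ r`: `f ∈ (y^ν) + 𝒥_{⌊r/q⌋ν+1}((y, x); (⌊r/q⌋, 1))`.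
[OURS · L1 W4.3 · audit glue; AI work, weaker than expert review; nothing here is a statement of the manuscript under review.]

## References

* D. Abramovich, M. H. Quek, B. Schober, arXiv:2507.01232 (2025), Thm 3.5. [AbramovichQuekSchober2025]
-/

noncomputable section

set_option linter.dupNamespace false -- mandated namespace of this single-conjunct summit

open IsLocalRing Literature.AlgebraicGeometry.Resolution
open Summit.ResolutionOfSingularities.ResolutionOfSingularities.Theorems
open Summit.ResolutionOfSingularities.ResolutionOfSingularities.Theorems.ContactCylinder

namespace Summit.ResolutionOfSingularities.ResolutionOfSingularities.Cruxes.HypersurfaceCentreConstruction.LocalEngine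

namespace Iota3

/-- The strict arithmetic of the floor: `q ∤ r`, `j < ν`, `rν ≤ r j + q i` force `⌊r/q⌋ ν + 1 ≤ ⌊r/q⌋ j + i`. [folklore] -/
theorem div_mul_succ_le_of_weights {q r ν i j : ℕ} (hqr : ¬ q ∣ r) (hjν : j < ν) (h : r * ν ≤ r * j + q * i) :
    r / q * ν + 1 ≤ r / q * j + i := by
  have hmod : 0 < r % q := Nat.pos_of_ne_zero (fun h0 => hqr (Nat.dvd_of_mod_eq_zero h0))
  have hdiv : q * (r / q) + r % q = r := Nat.div_add_mod r q
  obtain ⟨d, rfl⟩ : ∃ d, ν = j + d := ⟨ν - j, by omega⟩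
  have hd : 1 ≤ d := by omega
  have h1 : r * d ≤ q * i := by
    rw [Nat.mul_add] at h
    exact Nat.le_of_add_le_add_left h
  have h2 : q * (r / q * d) + d ≤ r * d :=
    calc q * (r / q * d) + d ≤ q * (r / q * d) + r % q * d := Nat.add_le_add_left (Nat.le_mul_of_pos_left d hmod) _
      _ = (q * (r / q) + r % q) * d := by ring
      _ = r * d := by rw [hdiv]
  have h3 : q * (r / q * d) < q * i := by
    have h5 : q * (r / q * d) + 1 ≤ q * (r / q * d) + d := Nat.add_le_add_left hd _
    exact Nat.lt_of_succ_le (h5.trans (h2.trans h1))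
  have h4 : r / q * d < i := Nat.lt_of_mul_lt_mul_left h3
  rw [Nat.mul_add, add_assoc]
  exact Nat.add_le_add_left h4 _

/-- **`𝒥_{rν}((y, x); (r, q)) ≤ (y^ν) ⊔ 𝒥_{⌊r/q⌋ν+1}((y, x); (⌊r/q⌋, 1))` for `q ∤ r`.** [OURS · L1 W4.3 · CURVE-TIE §3 (a)] -/
theorem weightedMonomialIdeal_le_span_pow_sup_div_succ {S : Type} [CommRing S] (y x : S) {q r : ℕ} (hqr : ¬ q ∣ r) (ν : ℕ) :
    weightedMonomialIdeal ![y, x] ![r, q] (r * ν) ≤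
      Ideal.span {y ^ ν} ⊔ weightedMonomialIdeal ![y, x] ![r / q, 1] (r / q * ν + 1) := by
  refine AQSHeightTwo.weightedMonomialIdeal_two_le fun i j hij => ?_
  rcases le_or_gt ν i with hνi | hiν
  · refine Ideal.mem_sup_left (Ideal.mem_span_singleton'.mpr ⟨y ^ (i - ν) * x ^ j, ?_⟩)
    rw [show y ^ i = y ^ (i - ν) * y ^ ν by rw [← pow_add, Nat.sub_add_cancel hνi]]
    ring
  · exact Ideal.mem_sup_right (AQSHeightTwo.monomial_mem y x (r / q) 1
      (by rw [one_mul]; exact div_mul_succ_le_of_weights hqr hiν hij))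

/-- **AQS admissibility IN `S`** at a curve centre: with the `S`-presented AQS germ `(y/1, x/1; r, q; rν)` of `f/1` at `S_P`, `P = (x, y)`,
`f ∈ 𝒥_{rν}((y, x); (r, q))` (the weighted piece on part of a regular system of parameters is contracted from `S_P`).
[OURS · L1 W4.3] [cite: AbramovichQuekSchober2025, Thm 3.5] -/
theorem mem_weightedMonomialIdeal_of_curve_lexMax {S : Type} [CommRing S] [IsRegularLocalRing S] (hd : ringKrullDim S = 3) {f : S}
    (P : Ideal S) [P.IsPrime] {x y z : S} (hPeq : Ideal.span ({x, y} : Set S) = P) (hxyz : Ideal.span {x, y, z} = maximalIdeal S)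
    {q r ν : ℕ} (hν1 : 1 ≤ ν)
    (hlex : IsLexMaxWeightedCentreGerm (Localization.AtPrime P) (Ideal.span {algebraMap S (Localization.AtPrime P) f})
      ![algebraMap S (Localization.AtPrime P) y, algebraMap S (Localization.AtPrime P) x] ![r, q] (r * ν)) :
    f ∈ weightedMonomialIdeal ![y, x] ![r, q] (r * ν) := by
  subst hPeq
  have hd3 : ringKrullDim S = (3 : ℕ) := by rw [hd]; rfl
  have hrk : (maximalIdeal S).spanFinrank = 3 := by
    have h := IsRegularLocalRing.spanFinrank_maximalIdeal (R := S)
    rw [hd3] at h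
    exact_mod_cast h
  have hpos : ∀ i, 0 < (![r, q] : Fin 2 → ℕ) i := hlex.2.1
  have hr : 0 < r := hpos 0
  have hadmO := (Ideal.span_singleton_le_iff_mem _).mp hlex.2.2.2.2.2.2.1
  have hyxz : Ideal.span (Set.range ![y, x, z]) = maximalIdeal S := by rw [range_three, Set.insert_comm]; exact hxyz
  have hyx : ∀ i, (![y, x] : Fin 2 → S) i ∈ maximalIdeal S := LocalGameEFTCylinder.mem_maximalIdeal_pair hyxz
  have hli := LocalGameEFTCylinder.linearIndependent_toCotangent_pair hyxz hrk
  have hu𝔭 : ∀ i, (![y, x] : Fin 2 → S) i ∈ Ideal.span ({x, y} : Set S) := by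
    intro i; fin_cases i
    · exact Ideal.subset_span (Set.mem_insert_of_mem _ (Set.mem_singleton _))
    · exact Ideal.subset_span (Set.mem_insert _ _)
  rw [← comap_map_weightedMonomialIdeal_eq_of_linearIndependent (Ideal.span ({x, y} : Set S)) ![y, x] hyx hli hu𝔭 ![r, q] hpos
    (Nat.mul_pos hr hν1), Ideal.mem_comap, weightedMonomialIdeal_map]
  have hvec : (fun i => algebraMap S (Localization.AtPrime (Ideal.span ({x, y} : Set S))) ((![y, x] : Fin 2 → S) i)) =
      ![algebraMap S (Localization.AtPrime (Ideal.span ({x, y} : Set S))) y,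
        algebraMap S (Localization.AtPrime (Ideal.span ({x, y} : Set S))) x] := by
    funext i; fin_cases i <;> rfl
  rw [hvec]; exact hadmO

/-- **CURVE-TIE §3 (a) in `S`**: at a curve centre whose `S`-presented AQS germ has FRACTIONAL slope (`q ∤ r`),
`f ∈ (y^ν) + 𝒥_{⌊r/q⌋ν+1}((y, x); (⌊r/q⌋, 1))` — `f` is `c·y^ν` modulo the next integer piece of `J₃ᵗ = 𝒥((y, x); (⌊r/q⌋, 1))`
(…Iota3DropCurveFracNormal). [OURS · L1 W4.3 · (D-b³-curve-FRAC-TIE) first reduction] [cite: AbramovichQuekSchober2025, Thm 3.5] -/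
theorem mem_span_pow_sup_of_curve_lexMax_frac {S : Type} [CommRing S] [IsRegularLocalRing S] (hd : ringKrullDim S = 3) {f : S}
    (P : Ideal S) [P.IsPrime] {x y z : S} (hPeq : Ideal.span ({x, y} : Set S) = P) (hxyz : Ideal.span {x, y, z} = maximalIdeal S)
    {q r ν : ℕ} (hν1 : 1 ≤ ν) (hqr : ¬ q ∣ r)
    (hlex : IsLexMaxWeightedCentreGerm (Localization.AtPrime P) (Ideal.span {algebraMap S (Localization.AtPrime P) f})
      ![algebraMap S (Localization.AtPrime P) y, algebraMap S (Localization.AtPrime P) x] ![r, q] (r * ν)) :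
    f ∈ Ideal.span {y ^ ν} ⊔ weightedMonomialIdeal ![y, x] ![r / q, 1] (r / q * ν + 1) :=
  weightedMonomialIdeal_le_span_pow_sup_div_succ y x hqr ν (mem_weightedMonomialIdeal_of_curve_lexMax hd P hPeq hxyz hν1 hlex)

end Iota3

end Summit.ResolutionOfSingularities.ResolutionOfSingularities.Cruxes.HypersurfaceCentreConstruction.LocalEngine

end
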